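import Literature.Analysis.ODE.OneSidedComparison
import HarnessLib

/-!
# Dissipative tail modes and the isolation step of the method of self-consistent bounds

Topic `Literature/Analysis/ODE`. The two elementary facts behind the TAIL part of one time step
of a rigorous integrator for a dissipative PDE written in (Fourier–)Galerkin coordinates
`a_k' = -λ_k a_k + N_k(a)` (`λ_k → +∞`; Zgliczyński–Mischaikow 2001, Zgliczyński 2002/2004,
Wilczak–Zgliczyński 2025):

* (`abs_le_of_dissipativeMode`, `abs_le_max_of_dissipativeMode`) ONE DISSIPATIVE LINEAR MODE WITH
  BOUNDED FORCING: if `u` is continuous on `[a, b]` with right derivative `u'` on `[a, b)`,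
  `λ > 0` and `|u' + λ u| ≤ F` on `[a, b)` (i.e. `u' = -λ u + f`, `|f| ≤ F`), then for
  `t ∈ [a, b]`
  `|u t| ≤ |u a| e^{-λ (t - a)} + (F/λ) (1 - e^{-λ (t - a)}) ≤ max (|u a|, F/λ)`
  (variation of constants; the interval `[-R, R]`, `R = max (|u a|, F/λ)`, is forward invariant
  because at `u = ±R` the field points inwards — the ISOLATION of the mode, Zgliczyński 2002,
  eq. (4.4) and Def. 4.2).
* (`tailIsolation_step`) THE ISOLATION STEP (first-exit / continuity argument; Zgliczyński 2002
  Lemma 4.3 "isolation for all blocks ⇒ trapping region"; Wilczak–Zgliczyński 2025, proof of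
  Thm. 17: "the only way a trajectory may escape is through the leading coordinates"). On a time
  step `[0, h]` let the unknowns split into LEADING MODES `y t` (any type) and finitely many TAIL
  MODES `a j t ∈ ℝ`, continuous with right derivatives `a' j t`. Suppose: (H1) as long as every
  tail mode obeys its trial bound `|a j| ≤ τ j` on `[0, s]`, the leading modes lie in the box `Y`
  on `[0, s]` (this is what a validated ODE step for the leading modes, with the tail as a bounded
  perturbation, delivers — cf. `HighOrderEnclosure.lean`); (H2) whenever `y t ∈ Y` and all
  `|a j t| ≤ τ j`, the tail forcing is bounded, `|a' j t + λ j a j t| ≤ F j`; (H3) isolation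
  margins `0 < λ j`, `F j / λ j < τ j`, `|a j 0| < τ j`. THEN nothing escapes during the step:
  for all `t ∈ [0, h]`, `y t ∈ Y` and every tail mode obeys the exponential bound above (hence
  `≤ max (|a j 0|, F j/λ j) < τ j`).

These are Lemma T1 (a)/(b) and the "first exit" paragraph of the step theorem that the
`cap.pde` verifiers re-derive (tail bounds (iii)–(v) of a `cap-pde-cert` step). Related tree
result: `norm_le_of_hasDerivAt_dissipative_forced` (`CarlemanTruncationDissipative.lean`: the
inner-product form with zero initial datum); the comparison tools are those of
`OneSidedComparison.lean` / `MaximalTime.lean`.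

## References

* P. Zgliczyński, *Attracting fixed points for the Kuramoto–Sivashinsky equation: a computer
  assisted proof*, SIAM J. Appl. Dyn. Syst. 1 (2002) 215–235, §4: eq. (4.4), Def. 4.2,
  Lemma 4.3. [Zgliczynski2002]
* P. Zgliczyński, K. Mischaikow, *Rigorous numerics for partial differential equations: the
  Kuramoto–Sivashinsky equation*, Found. Comput. Math. 1 (2001) 255–288, §3.3 (the tail of
  self-consistent bounds). [ZgliczynskiMischaikow2001]
* D. Wilczak, P. Zgliczyński, *Self-consistent bounds method for dissipative PDEs*,
  arXiv:2502.09760 (2025), §6 (isolation property), Thm. 17. [WilczakZgliczynski2025]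
-/

noncomputable section

open Set Real Filter Topology

namespace Literature.Analysis.ODE

/-! ### One dissipative linear mode with bounded forcing -/

/-- **A dissipative mode with bounded forcing, exponential bound (variation of constants).** If
`u` is continuous on `[a, b]` with right derivative `u'` on `[a, b)`, `λ > 0`, and
`|u' t + λ u t| ≤ F` on `[a, b)`, then
`|u t| ≤ |u a| e^{-λ (t - a)} + (F/λ)(1 - e^{-λ (t - a)})` for `t ∈ [a, b]`.
[cite: Zgliczynski2002, §4 eq. (4.4) & Def. 4.2] -/
theorem abs_le_of_dissipativeMode {u u' : ℝ → ℝ} {a b lam F : ℝ}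
    (hu : ContinuousOn u (Icc a b)) (hu' : ∀ t ∈ Ico a b, HasDerivWithinAt u (u' t) (Ici t) t)
    (hlam : 0 < lam) (bound : ∀ t ∈ Ico a b, |u' t + lam * u t| ≤ F) {t : ℝ}
    (ht : t ∈ Icc a b) :
    |u t| ≤ |u a| * exp (-lam * (t - a)) + F / lam * (1 - exp (-lam * (t - a))) := by
  have hK : (-lam) ≠ 0 := by linarith
  have hup := le_gronwallBound_of_deriv_right_le (α := F) (β := -lam) hu hu'
    (fun s hs => by have := (abs_le.mp (bound s hs)).2; linarith) t ht
  have hlo := gronwallBound_neg_le_of_le_deriv_right (α := F) (β := -lam) hu hu'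
    (fun s hs => by have := (abs_le.mp (bound s hs)).1; linarith) t ht
  rw [gronwallBound_of_K_ne_0 hK] at hup hlo
  simp only at hup hlo
  have he0 : 0 ≤ exp (-lam * (t - a)) := (exp_pos _).le
  have he1 : exp (-lam * (t - a)) ≤ 1 := by
    apply exp_le_one_iff.mpr
    have : 0 ≤ t - a := by linarith [ht.1]
    nlinarith
  have hua : u a ≤ |u a| := le_abs_self _
  have hua' : -|u a| ≤ u a := neg_abs_le _
  have hdiv : F / (-lam) * (exp (-lam * (t - a)) - 1) = F / lam * (1 - exp (-lam * (t - a))) := by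
    rw [div_neg]
    ring
  rw [hdiv] at hup hlo
  rw [abs_le]
  constructor
  · nlinarith
  · nlinarith

/-- **A dissipative mode with bounded forcing, uniform bound (isolation).** Under the hypotheses
of `abs_le_of_dissipativeMode`, `|u t| ≤ max (|u a|) (F/λ)` on `[a, b]`: the symmetric interval of
radius `max (|u a|, F/λ)` is forward invariant. [cite: Zgliczynski2002, §4 Def. 4.2 & Lemma 4.3] -/
theorem abs_le_max_of_dissipativeMode {u u' : ℝ → ℝ} {a b lam F : ℝ}
    (hu : ContinuousOn u (Icc a b)) (hu' : ∀ t ∈ Ico a b, HasDerivWithinAt u (u' t) (Ici t) t)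
    (hlam : 0 < lam) (bound : ∀ t ∈ Ico a b, |u' t + lam * u t| ≤ F) {t : ℝ}
    (ht : t ∈ Icc a b) : |u t| ≤ max |u a| (F / lam) := by
  have h := abs_le_of_dissipativeMode hu hu' hlam bound ht
  have he0 : 0 ≤ exp (-lam * (t - a)) := (exp_pos _).le
  have he1 : exp (-lam * (t - a)) ≤ 1 := by
    apply exp_le_one_iff.mpr
    have : 0 ≤ t - a := by linarith [ht.1]
    nlinarith
  have h1 : |u a| ≤ max |u a| (F / lam) := le_max_left _ _
  have h2 : F / lam ≤ max |u a| (F / lam) := le_max_right _ _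
  nlinarith

/-! ### The isolation step: nothing escapes through the tail -/

/-- **Isolation step of the method of self-consistent bounds** (first-exit argument). Leading
modes `y : ℝ → M` (any type `M`, box `Y : Set M`), finitely many tail modes `a j : ℝ → ℝ`
continuous on `[0, h]` with right derivatives `a' j` on `[0, h)`. Hypotheses: (H1) for every
`s ∈ [0, h]`, if all tail modes obey `|a j t| ≤ τ j` on `[0, s]` then `y t ∈ Y` on `[0, s]`;
(H2) for `t ∈ [0, h)`, `y t ∈ Y` and `|a j t| ≤ τ j` for all `j` imply
`|a' j t + λ j * a j t| ≤ F j` for all `j`; (H3) `0 < λ j`, `F j / λ j < τ j` and `|a j 0| < τ j`.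
Conclusion: for every `t ∈ [0, h]`, `y t ∈ Y` and
`|a j t| ≤ |a j 0| e^{-λ j t} + (F j/λ j)(1 - e^{-λ j t})` for every `j` (in particular
`≤ max (|a j 0|, F j/λ j) < τ j`: the trial tail bounds are never reached).
[cite: Zgliczynski2002, §4 Lemma 4.3; WilczakZgliczynski2025, Thm. 17 (proof)] -/
theorem tailIsolation_step {ι : Type*} [Finite ι] {M : Type*} {y : ℝ → M} {Y : Set M}
    {a a' : ι → ℝ → ℝ} {lam F τ : ι → ℝ} {h : ℝ} (hh : 0 ≤ h)
    (hac : ∀ j, ContinuousOn (a j) (Icc 0 h))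
    (ha' : ∀ j, ∀ t ∈ Ico 0 h, HasDerivWithinAt (a j) (a' j t) (Ici t) t)
    (H1 : ∀ s ∈ Icc 0 h, (∀ t ∈ Icc 0 s, ∀ j, |a j t| ≤ τ j) → ∀ t ∈ Icc 0 s, y t ∈ Y)
    (H2 : ∀ t ∈ Ico 0 h, y t ∈ Y → (∀ j, |a j t| ≤ τ j) → ∀ j, |a' j t + lam j * a j t| ≤ F j)
    (hlam : ∀ j, 0 < lam j) (hiso : ∀ j, F j / lam j < τ j) (h0 : ∀ j, |a j 0| < τ j) {t : ℝ}
    (ht : t ∈ Icc 0 h) :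
    y t ∈ Y ∧ ∀ j, |a j t| ≤ |a j 0| * exp (-lam j * t) + F j / lam j * (1 - exp (-lam j * t)) := by
  classical
  -- the tail constraint and its maximal time
  set P : ℝ → Prop := fun s => ∀ j, |a j s| ≤ τ j with hP_def
  have hP0 : P 0 := fun j => (h0 j).le
  -- KEY: if the tail constraint holds on `[0, S]`, then the conclusions hold on `[0, S]`
  have key : ∀ S ∈ Icc 0 h, (∀ s ∈ Icc 0 S, P s) → ∀ s ∈ Icc 0 S,
      y s ∈ Y ∧ ∀ j, |a j s| ≤ |a j 0| * exp (-lam j * s) + F j / lam j * (1 - exp (-lam j * s)) := by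
    intro S hS hPS s hs
    have hY : ∀ u ∈ Icc 0 S, y u ∈ Y := H1 S hS fun u hu j => hPS u hu j
    refine ⟨hY s hs, fun j => ?_⟩
    have hb := abs_le_of_dissipativeMode (u := a j) (u' := a' j) (a := 0) (b := S) (lam := lam j)
      (F := F j) ((hac j).mono (Icc_subset_Icc_right hS.2))
      (fun u hu => ha' j u ⟨hu.1, hu.2.trans_le hS.2⟩) (hlam j)
      (fun u hu => H2 u ⟨hu.1, hu.2.trans_le hS.2⟩ (hY u (Ico_subset_Icc_self hu))
        (hPS u (Ico_subset_Icc_self hu)) j) hs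
    simpa using hb
  -- closedness of the tail constraint under limits from the left
  have hclosed : ∀ s ∈ Ioc 0 h, (∀ u ∈ Ico 0 s, P u) → P s := by
    intro s hs hPu j
    by_contra hcon
    have hlt : τ j < |a j s| := lt_of_not_ge hcon
    have hcont : ContinuousWithinAt (fun u => |a j u|) (Icc 0 h) s :=
      (continuous_abs.continuousAt).comp_continuousWithinAt ((hac j) s ⟨hs.1.le, hs.2⟩)
    rw [Metric.continuousWithinAt_iff] at hcont
    obtain ⟨δ, hδ, hδc⟩ := hcont (|a j s| - τ j) (by linarith)
    set u := max 0 (s - δ / 2) with hu_def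
    have hu0 : 0 ≤ u := le_max_left _ _
    have hus : u < s := max_lt hs.1 (by linarith)
    have hud : dist u s < δ := by
      rw [Real.dist_eq, abs_of_nonpos (by linarith)]
      have : s - δ / 2 ≤ u := le_max_right _ _
      linarith
    have h1 := hδc (x := u) ⟨hu0, hus.le.trans hs.2⟩ hud
    rw [Real.dist_eq] at h1
    have h2 : |a j u| ≤ τ j := hPu u ⟨hu0, hus⟩ j
    have h3 := (abs_lt.mp h1).1
    linarith
  -- the maximal time is `h`
  set T := maximalTimeP P 0 h with hT_def
  have hT : T ∈ Icc 0 h := maximalTimeP_mem hh hP0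
  have hPT : ∀ s ∈ Icc 0 T, P s := fun s hs => maximalTimeP_spec hh hP0 hclosed hs
  have hTh : T = h := by
    by_contra hne
    have hlt : T < h := lt_of_le_of_ne hT.2 hne
    -- at `T` the tail bounds hold strictly, hence (finitely many modes, continuity) near `T`
    have hstrict : ∀ j, |a j T| < τ j := fun j => by
      have hb := (key T hT hPT T ⟨hT.1, le_rfl⟩).2 j
      have he0 : 0 < exp (-lam j * T) := exp_pos _
      have he1 : exp (-lam j * T) ≤ 1 := by
        apply exp_le_one_iff.mpr
        nlinarith [hT.1, hlam j]
      have hm1 : |a j 0| * exp (-lam j * T) < τ j * exp (-lam j * T) :=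
        mul_lt_mul_of_pos_right (h0 j) he0
      have hm2 : F j / lam j * (1 - exp (-lam j * T)) ≤ τ j * (1 - exp (-lam j * T)) :=
        mul_le_mul_of_nonneg_right (hiso j).le (by linarith)
      linarith
    have hev : ∀ᶠ s in 𝓝[Icc 0 h] T, P s := by
      have hj : ∀ j, ∀ᶠ s in 𝓝[Icc 0 h] T, |a j s| < τ j := fun j => by
        have hcont : ContinuousWithinAt (fun u => |a j u|) (Icc 0 h) T :=
          (continuous_abs.continuousAt).comp_continuousWithinAt ((hac j) T hT)
        exact hcont.eventually_mem (Iio_mem_nhds (hstrict j))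
      filter_upwards [eventually_all.2 hj] with s hs j using (hs j).le
    exact not_eventually_of_maximalTimeP_lt hh hP0 hlt hev
  -- conclude on `[0, h]`
  have hPh : ∀ s ∈ Icc 0 h, P s := fun s hs => hPT s (hTh ▸ hs)
  exact key h ⟨hh, le_rfl⟩ hPh t ht

/-- **Isolation step, uniform form.** Under the hypotheses of `tailIsolation_step`, for every
`t ∈ [0, h]`: `y t ∈ Y` and `|a j t| ≤ max (|a j 0|) (F j/λ j)` (`< τ j`) for every tail mode.
[cite: Zgliczynski2002, §4 Lemma 4.3] -/
theorem tailIsolation_step_max {ι : Type*} [Finite ι] {M : Type*} {y : ℝ → M} {Y : Set M}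
    {a a' : ι → ℝ → ℝ} {lam F τ : ι → ℝ} {h : ℝ} (hh : 0 ≤ h)
    (hac : ∀ j, ContinuousOn (a j) (Icc 0 h))
    (ha' : ∀ j, ∀ t ∈ Ico 0 h, HasDerivWithinAt (a j) (a' j t) (Ici t) t)
    (H1 : ∀ s ∈ Icc 0 h, (∀ t ∈ Icc 0 s, ∀ j, |a j t| ≤ τ j) → ∀ t ∈ Icc 0 s, y t ∈ Y)
    (H2 : ∀ t ∈ Ico 0 h, y t ∈ Y → (∀ j, |a j t| ≤ τ j) → ∀ j, |a' j t + lam j * a j t| ≤ F j)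
    (hlam : ∀ j, 0 < lam j) (hiso : ∀ j, F j / lam j < τ j) (h0 : ∀ j, |a j 0| < τ j) {t : ℝ}
    (ht : t ∈ Icc 0 h) :
    y t ∈ Y ∧ ∀ j, |a j t| ≤ max |a j 0| (F j / lam j) := by
  obtain ⟨hY, hb⟩ := tailIsolation_step hh hac ha' H1 H2 hlam hiso h0 ht
  refine ⟨hY, fun j => ?_⟩
  have hbj := hb j
  have he0 : 0 ≤ exp (-lam j * t) := (exp_pos _).le
  have he1 : exp (-lam j * t) ≤ 1 := by
    apply exp_le_one_iff.mpr
    nlinarith [ht.1, hlam j]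
  have h1 : |a j 0| ≤ max |a j 0| (F j / lam j) := le_max_left _ _
  have h2 : F j / lam j ≤ max |a j 0| (F j / lam j) := le_max_right _ _
  nlinarith

end Literature.Analysis.ODE

end
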